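import Summits.BirchSwinnertonDyer.Rank1Residual.GaloisImage.LocalThreeTorsionAdicCompletion
import Summits.BirchSwinnertonDyer.Rank1Residual.GaloisImage.LocalTorsionAwayFromPAdicCompletion
import Summits.BirchSwinnertonDyer.Rank1Residual.GaloisImage.VisibleLowerBoundThree
import Summits.BirchSwinnertonDyer.Rank1Residual.Additive.X4RankZeroVisibleLowerBoundPrimeList
import Summits.BirchSwinnertonDyer.Rank1Residual.Additive.IntModelTamagawaCertificateLocal
import Summits.BirchSwinnertonDyer.Rank1Residual.X11b.VisibilityPrimeList
import Summits.BirchSwinnertonDyer.Rank1Residual.X11b.ChaPairsMinimality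
import Summits.BirchSwinnertonDyer.BirchSwinnertonDyer.Theorems.Rank1ResidualIntModelReduction
import Summits.BirchSwinnertonDyer.Rank1Residual.X10.CasselsTatePairingRecordsB
import Literature.NumberTheory.EllipticCurves.SelmerCorankControlRatProofs
import HarnessLib

/-!
# N2 (X10b @ 3): the SELF-TWIST visible lower bound for the CTP target `322624k1` — a non-zero element
# of `Ш(E)[3]` and `3² ∣ #Ш(E)[3^∞]` from the rank-2 self-twist `322624i1`, every local binder in the kernel
# (cell `b2b-bsdres`, unit `b2b-bsdres-x10` = N2 class lead, GEN 21; per-pair RECORD, closes nothing)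

HONEST FRAMING (cell `b2b-bsdres`, run/shared/lean/b2b/bsd-rank1-residual/, verbatim in every
file): the goal of the cell is to DELETE the COMBINATION-SHAPED residual classes of the
Birch–Swinnerton-Dyer formula for ALL analytic-rank `≤ 1` elliptic curves over `ℚ` — "full BSD
formula for every rank `≤ 1` curve in class `C`" assembled STRICTLY from published theorems — so
that the rank-`≤ 1` remainder becomes exactly the CONSTRUCTION-SHAPED classes, which are TYPED
(missing-input `Prop`s), NOT attempted. This is not "finishing BSD". Class X10b (= N2) stays
CONSTRUCTION-SHAPED (NEEDS `X_A3`); this file is a PER-PAIR RECORD of the LOWER half only; nothing is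
booked; no mark / label / tier / count is changed. Theorems only (no definition, no named fact, no
`sorry`).

## What

The N2 'self-twist law' (x10 GEN 21, `HOME/b2b-bsdres-x10/g21/selftwist/SELF-TWIST-LAW.md`): a `3Ns`
curve `E` and its quadratic twist `E′ = E ⊗ χ_{d*}` by the dihedral field `ℚ(√d*)` have `E′[3] ≅ E[3]`,
and when `E` has no inert multiplicative prime `≡ 2 (3)` and no off-eigenline split prime `≡ 1 (3)` the
two `3`-Selmer groups coincide; on the nine rank-0 Ш-cells of N2 with that property the twin has
Mordell–Weil rank `2`.  This file turns ONE of them into a kernel record by the tree's VISIBILITY count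
(x11a's `WeierstrassCurve.exists_sha_ne_zero_of_congr_of_rank`, Cremona–Mazur / Agashe–Stein shape, `p ∣ N`
allowed, the place of `3` PAID): **`E = 322624k1 = [0, -1, 0, -45335393, -116524739615]`** (`N = 322624 =
2⁶·71²`, good ordinary non-anomalous at `3`, image `3Ns`, `d* = -71`, `r_an = 0`, `#Ш_an = 9`; CTP target of
x10's fourteen) with the self-twist **`E′ = 322624i1 = [0, -1, 0, -8993, 328609]`** (rank `2`, Cremona
generators `(95, 568)`, `(24, 355)`; `#Ш_an(E′) = 1`).  `S` = the places over `[2, 3, 71]`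
(`|Δ(E)| = 2²¹·71⁹`, `|Δ(E′)| = 2²¹·71³`); the partner's local binder `#E′(ℚ_v)[3] = 1` is discharged IN THE
KERNEL at every place of `S`: `v = 2` additive `I*₁₃`-type (TamLocal certificate, value set `{2,4}`),
`v = 71` additive `III` (`c = 2`), `v = 3` by n1011-p17's decider (`k = 2`, one certificate line) — all
three produced by n1011-p18's glue `g9/tools/vis3_certs.py` UNCHANGED and re-decided here by
`decide +kernel`.  `E[3]` irreducible in the kernel from the Frobenius witness `ℓ = 7`
(`#Ẽ(𝔽₇) = 5`, `X² − 3X + 7 ≡ X² + 1` rootless mod `3`).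
* `irr3_v322624k1` — E-side kernel fact (over x10 GEN 12's landed point count `X10.card_t322624k1_7`);
* `tamLocal_check_322624i1_2`, `tamLocal_check_322624i1_71` — the partner's Tate certificates;
* **`exists_sha_three_selfTwist_v322624k1`** — `∃ c ∈ Ш(E), c ≠ 0, 3c = 0`;
* **`sq_dvd_card_sha_three_selfTwist_v322624k1`** — `3² ∣ #Ш(E)[3^∞]` (Cassels–Tate parity `hCT`);
* **`missingLowerBoundAt_three_selfTwist_v322624k1`** — the typed LOWER binder `MissingLowerBoundAt W 3`
  given the analytic datum `#Ш_an = 9`.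
BINDERS LEFT (displayed, EVIDENCE columns — nothing booked): the named facts `hCT` (Cassels–Tate) and `hGZK`
(Gross–Zagier–Kolyvagin), `hr : r_an(E) = 0` (Cremona), the congruence `θ : E′[3] ≃ E[3]` (`hθ`; self-twist
by `d* = -71`: `ρ̄ ⊗ χ_{-71} ≅ ρ̄` for the `3Ns` image — EVIDENCE: cc-eng-2 KO-certified `CONG-certified-eng2.tsv`
row 322624k/322624i, Kraus–Oesterlé bound 81 791, 7 997 primes, kit j123296), `hrank : 2 ≤ rank E′(ℚ)`
(Cremona `allgens`), and `hq : #Ш_an = 9` for the typed binder.  The UPPER half at this pair is NOT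
touched (X_A3; the Cassels–Tate certificate route of record is x10 GEN 8–17's).

References: [CremonaMazur2000] §3; [AgasheStein2002] Thm. 3.1; [MazurRubin2010] Lemma 3.2;
[Mazur1978] Prop. 6.3 (1); [SilvermanAEC2009] VII.1 Rem. 1.1, VII.5.1, X.4.14; [SilvermanATAEC1994] IV.9.4;
[Cremona2006] Table 1 (labels 322624k1, 322624i1).
-/

set_option autoImplicit false

noncomputable section

open scoped Classical NumberField
open IsDedekindDomain NumberField WeierstrassCurve Rat.HeightOneSpectrum
  Literature.NumberTheory.EllipticCurves Literature.NumberTheory.EllipticCurves.ModularForms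
  Literature.NumberTheory.EllipticCurves.Rank1Residual
  Literature.NumberTheory.EllipticCurves.Rank1Residual.Typed
  Literature.NumberTheory.GaloisRepresentations
  Summit.BirchSwinnertonDyer.BirchSwinnertonDyer.Rank1Residual.IntModel
  Summit.BirchSwinnertonDyer.BirchSwinnertonDyer.Rank1Residual.X11RankOne
  Summit.BirchSwinnertonDyer.BirchSwinnertonDyer.Rank2Observatory
  Summit.BirchSwinnertonDyer.BirchSwinnertonDyer.Rank2Observatory.Tam
  Summit.BirchSwinnertonDyer.Rank1Residual.GaloisImage
  Summit.BirchSwinnertonDyer.Rank1Residual.Additive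
  Summit.BirchSwinnertonDyer.Rank1Residual.X11b

namespace Summit.BirchSwinnertonDyer.Rank1Residual.X10.SelfTwist

/-! ### E-side kernel fact for `322624k1` (the point count at `7` is x10 GEN 12's `X10.card_t322624k1_7`) -/

/-- The Frobenius polynomial of `322624k1` at `7` reduced mod `3`, `X² − 3X + 7 ≡ X² + 1`, has no root in `𝔽₃`. [folklore] -/
theorem noroot3_frob_v322624k1_7 :
    ∀ t : ZMod 3, t ^ 2 - ((((7 : ℕ) : ℤ) + 1 - (5 : ℕ) : ℤ) : ZMod 3) * t + ((7 : ℕ) : ZMod 3) ≠ 0 := by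
  decide

/-- **`E[3]` is irreducible for Cremona 322624k1** from the Frobenius witness `ℓ = 7`: `a_7 = 3` and
`X² − 3X + 7 ≡ X² + 1 (mod 3)` has no root (Mazur 1978 Prop. 6.3 (1), tree
`hasIrreducibleModPGaloisRep_of_intModel_of_noroot`). [cite: Mazur1978, §6 Prop. 6.3 (1) (p. 153)] -/
theorem irr3_v322624k1 {W : WeierstrassCurve ℚ} [W.IsElliptic] [W.IsGloballyMinimal]
    (hI : integralModelInt W = ⟨0, -1, 0, -45335393, -116524739615⟩) : W.HasIrreducibleModPGaloisRep 3 :=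
  haveI : Fact (Nat.Prime 3) := ⟨Nat.prime_three⟩
  haveI : Fact (Nat.Prime 7) := ⟨by norm_num⟩
  hasIrreducibleModPGaloisRep_of_intModel_of_noroot hI 3 7 (by norm_num) (by decide +kernel)
    Summit.BirchSwinnertonDyer.Rank1Residual.X10.card_t322624k1_7 noroot3_frob_v322624k1_7

/-! ### The partner's Tate certificates at `2` and `71` -/

/-- The local Tamagawa certificate of the self-twist `322624i1` at `2` (`TamLocal` = `⟨2, 1, 5, 0, 25, 0, 64, 21, 71, 5, 4⟩`,
additive `I*`-type) passes the kernel check. [cite: SilvermanATAEC1994, IV.9.4] -/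
theorem tamLocal_check_322624i1_2 :
    TamLocal.check ⟨2, 1, 5, 0, 25, 0, 64, 21, 71, 5, 4⟩ ⟨0, -1, 0, -8993, 328609⟩ = true := by
  decide +kernel

/-- The local Tamagawa certificate of the self-twist `322624i1` at `71` (`TamLocal` = `⟨71, 8, 4, 0, 24, 0, 0, 3, 3, 2, 2⟩`,
additive type `III`, `c = 2`) passes the kernel check. [cite: SilvermanATAEC1994, IV.9.4] -/
theorem tamLocal_check_322624i1_71 :
    TamLocal.check ⟨71, 8, 4, 0, 24, 0, 0, 3, 3, 2, 2⟩ ⟨0, -1, 0, -8993, 328609⟩ = true := by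
  decide +kernel

/-! ### The visible element of `Ш(322624k1)[3]` -/

/-- **SELF-TWIST VISIBILITY RECORD (closes nothing, moves no mark): a non-zero `3`-torsion element of
`Ш(E/ℚ)` for `E = 322624k1` from its rank-2 self-twist `E′ = 322624i1`, every local binder in the kernel.**
`S` = places over `[2, 3, 71]`; the place `3` costs `#(ℤ₃/3) = 3 < 9 = 3^{rank E′}` since `E′(ℚ₃)[3] = 0`
(good ordinary non-anomalous), and `E′(ℚ₂)[3] = E′(ℚ₇₁)[3] = 0` (additive, Tamagawa numbers `4` and `2`).
[cite: CremonaMazur2000, §3 and Table 1] [cite: AgasheStein2002, Thm. 3.1]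
[cite: Cremona2006, Table 1 (labels 322624k1, 322624i1)] -/
theorem exists_sha_three_selfTwist_v322624k1
    (hGZK : rank_eq_analyticRank_of_analyticRank_le_one)
    (W : WeierstrassCurve ℚ) [W.IsElliptic] [W.IsGloballyMinimal]
    (hI : integralModelInt W = ⟨0, -1, 0, -45335393, -116524739615⟩) (hr : W.analyticRank = 0)
    (W' : WeierstrassCurve ℚ) (hW' : W' = ⟨0, -1, 0, -8993, 328609⟩) [W'.IsElliptic]
    (θ : geomTorsion W' ((3 : ℕ) : ℤ) ≃+ geomTorsion W ((3 : ℕ) : ℤ))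
    (hθ : ∀ (σ : Field.absoluteGaloisGroup ℚ) (P : geomTorsion W' ((3 : ℕ) : ℤ)), θ (σ • P) = σ • θ P)
    (hrank : 2 ≤ W'.mordellWeilRank) :
    ∃ c : W.sha, c ≠ 0 ∧ 3 • c = 0 := by
  haveI : Fact (Nat.Prime 3) := ⟨Nat.prime_three⟩
  haveI : Fact (Nat.Prime 2) := ⟨by norm_num⟩
  haveI : Fact (Nat.Prime 71) := ⟨by norm_num⟩
  -- the row `322624k1`: `E(ℚ)` finite of order prime to `3`
  haveI hfin : Finite W.toAffine.Point := finite_point_of_analyticRank_eq_zero W hGZK hr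
  have hcop : (Nat.card W.toAffine.Point).Coprime 3 := coprime_natCard_point_of_irr W 3 (irr3_v322624k1 hI)
  have hE : (⟨0, -1, 0, -45335393, -116524739615⟩ : WeierstrassCurve ℤ).map (Int.castRingHom ℚ) = W := by
    rw [IntModelTam.eq_baseChange_of_integralModelInt hI]; rfl
  -- the partner `322624i1`: globally minimal, integral model
  have hM' : W'.IsGloballyMinimal := by
    rw [hW']
    exact isGloballyMinimal_of_krausCriterion_bounded₂ 0 (-1) 0 (-8993) 328609
      (by decide +kernel) (by decide +kernel) (by decide +kernel)
  have hI' : integralModelInt W' = ⟨0, -1, 0, -8993, 328609⟩ := by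
    subst hW'; exact integralModelInt_eq_of_map_eq _ (map_mk_int 0 (-1) 0 (-8993) 328609)
  have hF : (⟨0, -1, 0, -8993, 328609⟩ : WeierstrassCurve ℤ).map (Int.castRingHom ℚ) = W' := by
    rw [hW']; exact map_mk_int 0 (-1) 0 (-8993) 328609
  -- prime support of the two discriminants
  have hΔE : ∀ q : ℕ, q.Prime → (q : ℤ) ∣ (⟨0, -1, 0, -45335393, -116524739615⟩ : WeierstrassCurve ℤ).Δ → q ∈ [2, 3, 71] :=
    X11b.forall_mem_of_natAbs_eq_prod_pow [2, 3, 71] [21, 0, 9]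
      (by intro q hq; simp only [List.mem_cons, List.mem_nil_iff, or_false] at hq; rcases hq with rfl | rfl | rfl <;> norm_num)
      (by decide +kernel)
  have hΔF : ∀ q : ℕ, q.Prime → (q : ℤ) ∣ (⟨0, -1, 0, -8993, 328609⟩ : WeierstrassCurve ℤ).Δ → q ∈ [2, 3, 71] :=
    X11b.forall_mem_of_natAbs_eq_prod_pow [2, 3, 71] [21, 0, 3]
      (by intro q hq; simp only [List.mem_cons, List.mem_nil_iff, or_false] at hq; rcases hq with rfl | rfl | rfl <;> norm_num)
      (by decide +kernel)
  -- the finite set of places over `[2, 3, 71]`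
  set e := Rat.HeightOneSpectrum.primesEquiv (R := 𝓞 ℚ) with he
  set L : List ℕ := [2, 3, 71] with hLdef
  set S : Finset (HeightOneSpectrum (𝓞 ℚ)) :=
    (L.filterMap fun q ↦ if h : q.Prime then some (e.symm ⟨q, h⟩) else none).toFinset with hSdef
  have hmemS : ∀ v : HeightOneSpectrum (𝓞 ℚ), v ∈ S ↔ (e v : ℕ) ∈ L := by
    intro v
    rw [hSdef, List.mem_toFinset, List.mem_filterMap]
    constructor
    · rintro ⟨q, hq, hqv⟩
      by_cases hqp : q.Prime
      · rw [dif_pos hqp, Option.some.injEq] at hqv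
        rw [← hqv, Equiv.apply_symm_apply]
        exact hq
      · rw [dif_neg hqp] at hqv
        exact absurd hqv (by simp)
    · intro hv
      refine ⟨(e v : ℕ), hv, ?_⟩
      rw [dif_pos (e v).2]
      simp
  have hrank' : Module.finrank ℚ ℚ + 1 ≤ W'.mordellWeilRank := by rwa [Module.finrank_self]
  refine W.exists_sha_ne_zero_of_congr_of_rank W' (by norm_num) θ hθ S (fun v hvS ↦ ?_) hfin hcop hrank'
    (fun v hvS ↦ ?_)
  · -- good reduction of both curves outside `S`, and `v ∤ 3`
    have hvL : (e v : ℕ) ∉ L := fun h ↦ hvS ((hmemS v).mpr h)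
    have hq : (e v : ℕ).Prime := (e v).2
    refine ⟨?_, ?_, fun h3v ↦ hvL ?_⟩
    · rw [← hE]
      exact hasGoodReductionAt_map_of_not_dvd _ v fun h ↦ hvL (hΔE _ hq h)
    · rw [← hF]
      exact hasGoodReductionAt_map_of_not_dvd _ v fun h ↦ hvL (hΔF _ hq h)
    · rw [he, Rat.HeightOneSpectrum.primesEquiv_eq_of_natCast_mem v Nat.prime_three h3v, hLdef]
      simp
  · -- the partner's local binder at the three places of `S`
    have hvL : (e v : ℕ) ∈ L := (hmemS v).mp hvS
    rw [hLdef] at hvL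
    simp only [List.mem_cons, List.mem_nil_iff, or_false] at hvL
    rcases hvL with h2 | h3 | h71
    · -- `v = 2`: additive Kodaira In*, value set [2, 4]
      exact LocalTorsionAway.natCard_ker_nsmul_adicCompletion_eq_one_of_intModel_of_additive_tamLocal_forall hI' 2 3
        (by norm_num) h2 (by decide) (by decide) (E := ⟨2, 1, 5, 0, 25, 0, 64, 21, 71, 5, 4⟩) rfl
        tamLocal_check_322624i1_2 (by decide)
    · -- `v = 3`: good ordinary, non-anomalous; n1011-p17's decider, k = 2, cert = [(1, 1, 3, 0)], S = 0
      exact LocalTorsion3.natCard_ker_nsmul_three_adicCompletion_eq_one_of_check 0 (-1) 0 (-8993) 328609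
        (by decide +kernel) (k := 2) (cert := [((1 : ℤ), 1, 3, 0)]) (by decide +kernel) W' (by rw [hW']; norm_num) h3
    · -- `v = 71`: additive type III, `c = 2`
      exact LocalTorsionAway.natCard_ker_nsmul_adicCompletion_eq_one_of_intModel_of_additive hI' 71 3 (by norm_num) h71
        (by decide) (by decide)
        (IntModelTam.localTamagawaNumber_padic_eq_of_intModel_of_tamLocal hI' 71 (E := ⟨71, 8, 4, 0, 24, 0, 0, 3, 3, 2, 2⟩)
          rfl tamLocal_check_322624i1_71 (c := 2) (by decide)) (by norm_num)

/-- **`3² ∣ #Ш(322624k1)[3^∞]`** from the visible element and the Cassels–Tate parity (`hCT`).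
[cite: SilvermanAEC2009, Thm. X.4.14] [cite: CremonaMazur2000, §3 and Table 1] -/
theorem sq_dvd_card_sha_three_selfTwist_v322624k1
    (hCT : exists_casselsTate_pairing (K := ℚ)) (hGZK : rank_eq_analyticRank_of_analyticRank_le_one)
    (W : WeierstrassCurve ℚ) [W.IsElliptic] [W.IsGloballyMinimal]
    (hI : integralModelInt W = ⟨0, -1, 0, -45335393, -116524739615⟩) (hr : W.analyticRank = 0)
    (W' : WeierstrassCurve ℚ) (hW' : W' = ⟨0, -1, 0, -8993, 328609⟩) [W'.IsElliptic]
    (θ : geomTorsion W' ((3 : ℕ) : ℤ) ≃+ geomTorsion W ((3 : ℕ) : ℤ))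
    (hθ : ∀ (σ : Field.absoluteGaloisGroup ℚ) (P : geomTorsion W' ((3 : ℕ) : ℤ)), θ (σ • P) = σ • θ P)
    (hrank : 2 ≤ W'.mordellWeilRank) :
    3 ^ 2 ∣ Nat.card (AddCommGroup.primaryComponent W.sha 3) := by
  haveI : Finite W.sha := (hGZK W (by rw [hr]; exact zero_le_one)).2
  exact Visible.sq_dvd_card_sha_three_of_exists_sha_torsion hCT W
    (exists_sha_three_selfTwist_v322624k1 hGZK W hI hr W' hW' θ hθ hrank)

/-- **The typed LOWER binder `MissingLowerBoundAt E 3` for `322624k1`** (`ord₃ #Ш_an ≤ ord₃ #Ш`), from the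
visible `3`-torsion element, the Cassels–Tate squareness and the analytic datum `#Ш_an = 9` (`hq`, Cremona
`allbsd`; evidence binder). [cite: SilvermanAEC2009, Thm. X.4.14] [cite: Cremona2006, Table 1 (label 322624k1)] -/
theorem missingLowerBoundAt_three_selfTwist_v322624k1
    (hCT : exists_casselsTate_pairing (K := ℚ)) (hGZK : rank_eq_analyticRank_of_analyticRank_le_one)
    (W : WeierstrassCurve ℚ) [W.IsElliptic] [W.IsGloballyMinimal]
    (hI : integralModelInt W = ⟨0, -1, 0, -45335393, -116524739615⟩) (hr : W.analyticRank = 0)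
    {q : ℚ} (hq : shaAn W = (q : ℂ)) (hv : padicValRat 3 q ≤ 2)
    (W' : WeierstrassCurve ℚ) (hW' : W' = ⟨0, -1, 0, -8993, 328609⟩) [W'.IsElliptic]
    (θ : geomTorsion W' ((3 : ℕ) : ℤ) ≃+ geomTorsion W ((3 : ℕ) : ℤ))
    (hθ : ∀ (σ : Field.absoluteGaloisGroup ℚ) (P : geomTorsion W' ((3 : ℕ) : ℤ)), θ (σ • P) = σ • θ P)
    (hrank : 2 ≤ W'.mordellWeilRank) :
    haveI : Fact (Nat.Prime 3) := ⟨Nat.prime_three⟩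
    MissingLowerBoundAt W 3 := by
  haveI : Fact (Nat.Prime 3) := ⟨Nat.prime_three⟩
  have hvis := exists_sha_three_selfTwist_v322624k1 hGZK W hI hr W' hW' θ hθ hrank
  exact missingLowerBoundAt_of_casselsTate_of_pow_dvd W 3 hCT (hGZK W (by rw [hr]; exact zero_le_one)).2 hq
    (k := 1) (by simpa using hv) (by simpa using dvd_shaOrder_of_exists_torsion W 3 hvis)

end Summit.BirchSwinnertonDyer.Rank1Residual.X10.SelfTwist

end
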